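import Literature.AnabelianGeometry.SemiGraphs.FiniteEtaleCoveringDictionaryProofs2b
import Literature.AnabelianGeometry.SemiGraphs.FiniteEtaleCoveringGlobalDef
import Literature.AnabelianGeometry.SemiGraphs.FiniteEtaleCoveringVertexAligned
import HarnessLib

/-!
# The finite étale covering dictionary ([SemiAnbd] §2) — (D2) in UNTIED form, as a named theorem

Mochizuki, *Semi-graphs of anabelioids*, Publ. RIMS **42** (2006), §2 p. 23 / Remark 2.2.1 p. 24.
abc-iut cell, layer L3, row G30 (D2), RULING τ2 fallback (T′): the dictionary's (D2)
`covering_vertexFibre_doubleCosets` as filed in v3 (p411568) keeps a TIE between the counting bijection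
and the group clause which the hypotheses «local ∧ global ∧ vertex-aligned» do not supply for an
abstract covering (a system of distinct admissible representatives — audit A-L6d4-G30-F3); the UNTIED
statement below is what they do give, over the covering notion of record (abc-iut-L3-d3's
`Hom.IsGlobalCoveringOf`, abc-iut-L6-d4's `Hom.IsVertexAligned`).  It is the dictionary's (D2) text
(v3) with the single edit «`∃ g, DoubleCoset.mk … g = DoubleCoset.mk … (d v″) ∧ R` ⟶ `∃ g, R`», and is
proved by `covering_vertexFibre_doubleCosets_core` (`FiniteEtaleCoveringDictionaryProofs2b.lean`).
When the dictionary's decl is re-cut to this form, `covering_vertexFibre_doubleCosets_holds` is the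
same 6-line wrapper.  PROOF-ONLY file (no definitions).  Nothing here takes a side on [IUTchIII]
Cor. 3.12; typed ≠ discharged.
-/

namespace Literature.AnabelianGeometry.SemiGraphs

open CategoryTheory CategoryTheory.PreGaloisCategory
open Literature.AnabelianGeometry.Anabelioids
open scoped Pointwise

universe v₁ u₁ u

namespace SemiGraphOfAnabelioids

/-- **(D2), untied form, PROVED** ([SemiAnbd] §2 p. 23: "the vertices of `𝒢′` that lie over `v`
[are] the connected components of `S_v`"; Rem. 2.2.1 p. 24): for a connected finite étale covering
`φ : 𝒢′ → 𝒢` attached to `A` — locally (`IsFiniteEtaleCoveringOf`), globally (`IsGlobalCoveringOf`)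
and vertex-aligned (`IsVertexAligned`) — with basepoints through `v′` and `Π′ = ι(Π_{𝒢′}) = Stab(x₀)`:
there is `d` on the vertices over `v` inducing a BIJECTION onto `Π_v \ Π_𝒢 / Π′` with `d(v′) ∈ Π′`;
`ι(Π_{v′}) = Π′ ∩ Π_v`; and every verticial subgroup over `v`, read in `Π_𝒢` through any basepoint
transport, is a decomposition group `Π′ ∩ g⁻¹ Π_v g`.  (= the dictionary's (D2) text with the
group clause untied from `d`.) [cite: MochizukiSemiAnbd2006, Rem. 2.2.1 p.24] -/
theorem covering_vertexFibre_doubleCosets_untied :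
    ∀ (𝒢 𝒢' : SemiGraphOfAnabelioids.{v₁, u₁, u}) (φ : Hom 𝒢' 𝒢) (A : 𝒢.BObj),
    𝒢.IsConnected → 𝒢'.IsConnected → φ.IsFiniteEtaleCoveringOf A → φ.IsGlobalCoveringOf A →
    φ.IsVertexAligned →
    ∀ (v' : 𝒢'.graph.Vertex) (F' : 𝒢'.V v' ⥤ FintypeCat.{v₁}) [FiberFunctor F']
      (F : 𝒢.V (φ.base.vertexMap v') ⥤ FintypeCat.{v₁}) [FiberFunctor F]
      (e : (φ.φV v').pullback ⋙ F' ≅ F),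
      let v := φ.base.vertexMap v'
      let ι : 𝒢'.Pi v' F' →* 𝒢.Pi v F :=
        (Aut.autMulEquivOfIso (Functor.isoWhiskerLeft (𝒢.ρ v) e)).toMonoidHom.comp
          (pi1Map φ.pullbackFunctor (𝒢'.ρ v' ⋙ F'))
      let Pv : Subgroup (𝒢.Pi v F) := (𝒢.piVToPi v F).range
      ∀ x₀ : (𝒢.ρ v ⋙ F).obj A, ι.range = MulAction.stabilizer (𝒢.Pi v F) x₀ →
        ∃ d : {v'' : 𝒢'.graph.Vertex // φ.base.vertexMap v'' = v} → 𝒢.Pi v F,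
          Function.Bijective (fun v'' => DoubleCoset.mk Pv ι.range (d v'')) ∧
          d ⟨v', rfl⟩ ∈ ι.range ∧
          (ι.comp (𝒢'.piVToPi v' F')).range = ι.range ⊓ Pv ∧
          ∀ (v'' : {v'' : 𝒢'.graph.Vertex // φ.base.vertexMap v'' = v})
            (F'' : 𝒢'.V v''.1 ⥤ FintypeCat.{v₁}) [FiberFunctor F'']
            (α : 𝒢'.ρ v''.1 ⋙ F'' ≅ 𝒢'.ρ v' ⋙ F'),
            ∃ g : 𝒢.Pi v F,
              (ι.comp ((Aut.autMulEquivOfIso α).toMonoidHom.comp (𝒢'.piVToPi v''.1 F''))).range =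
                ι.range ⊓ ConjAct.toConjAct g⁻¹ • Pv := by
  intro 𝒢 𝒢' φ A h𝒢 h𝒢' hloc hB hV v' F' _ F _ e v ι Pv x₀ hx₀
  obtain ⟨hV3, hV4⟩ := hV v' F' F e
  exact covering_vertexFibre_doubleCosets_core h𝒢 h𝒢' φ A hloc hB v' F' F e hV3
    (fun v'' F'' _ α => hV4 v'' F'' α) x₀ hx₀

end SemiGraphOfAnabelioids

end Literature.AnabelianGeometry.SemiGraphs
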